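import Summits.AtomisticToContinuum.HydrodynamicLimit.Theorems.CollisionIsometryCLTAdaptedWeightCLTCBPathwiseBudget
import Summits.AtomisticToContinuum.HydrodynamicLimit.Theorems.CollisionIsometryCLTAdaptedWeightCLTCBTimeZero
import Summits.AtomisticToContinuum.HydrodynamicLimit.Theorems.CollisionIsometryCLTAdaptedWeightCLTCBTailsVmax
import Summits.AtomisticToContinuum.HydrodynamicLimit.Theorems.CollisionIsometryCLTAdaptedWeightCLTCBLipschitz

/-!
# Composition of the line `Sketch` (contact-balance) for the crux `AdaptedWeightCLT`
(stmt-AtomisticToContinuum-14868, rev-12 TIME-LOCAL form; route `CollisionIsometryCLT`, sub-problem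
`HydrodynamicLimit`; `--supports`; line lead `prover-line-stmt-AtomisticToContinuum-14868-c2-0`)

Six of the seven registered stubs of the line have landed (`stub_pointwise`, `stub_lipschitz`,
`stub_freeStretch`, `stub_pathwiseBudget`, `stub_timeZero`, `stub_tailsVmax`, files `…CBPointwise`,
`…CBLipschitz`, `…CBFreeStretch`, `…CBPathwiseBudget`, `…CBTimeZero`, `…CBTailsVmax`). Together they are the
PRODUCTION BUDGET of the Eulerian block-anisotropy balance: along good orbits
`prodColl ≤ anis(Φ₀ z) + K (N+1)^γ √(∫₀ᵗ (1+v_max)⁸) √X`, `X = ∫₀ᵗ ∫ₓ Σ D² + |q|²` (= the crux functional),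
with `anis(Φ₀ z) = O_P((N+1)^p)` and `∫₀ᵗ (1 + v_max)⁸ = O_P((N+1)^p)` for every `p > 0`.

This file records, sorry-free, what the budget buys:

* `tendsto_xint_of_coercivityOn`, `tendsto_xint_rate_of_coercivityOn` — PER-HORIZON, H1-FREE conditionals: at fixed
  `σ < 1/2`, `Φ`, kernel family and `t`, production coercivity on `[0,t]` at a power rate `β > γ` gives `P_N{δ < X} → 0`
  (every `δ > 0`) and `P_N{(N+1)^{−(β−γ)/2} < X} → 0` — the shape a PRE-SHOCK conditional bridge consumes (`t < T`).
* `adaptedWeightCLT_of_coercivity` — **the crux CONDITIONAL on one explicit hypothesis**, the seventh stub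
  `stub_coercivity` (COERCIVITY OF THE COLLISIONAL PRODUCTION AT A POWER RATE: for nice profiles and small
  `σ`, every flow family with H1, every admissible kernel family, every `t > 0` with H2 on `[0,t]`, there
  are `β > γ`, `η > 0`, `B` with `P_N{prodColl < η (N+1)^β X − B} → 0`), written out verbatim as the
  hypothesis `hcoe` (no `def`): `κ X ≤ A + b √X ⇒ X ≤ 2A/κ + (b/κ)²` and the three budget estimates give
  `X ≤ c (N+1)^{−(β−γ)}` off events of vanishing probability.
* `rate_of_coercivity` — the CERTIFICATE OF STRENGTH of that hypothesis: under the same hypothesis the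
  crux functional does not merely vanish in probability, it vanishes AT A POWER RATE,
  `P_N{(N+1)^{−(β−γ)/2} < X} → 0`. So `stub_coercivity` is (modulo the landed budget) the crux's
  conclusion WITH A RATE — at least crux-sized; this is the line lead's `promote-stub` evidence, kernel-checked.

Nothing here is asserted: the coercivity statement only ever appears as a hypothesis.
-/

namespace Summit.AtomisticToContinuum.HydrodynamicLimit.Theorems.ContactBalance

open scoped BigOperators Topology Classical MeasureTheory ENNReal InnerProductSpace
open Filter Set MeasureTheory
open Literature.Analysis.FluidPDE
open Summit.AtomisticToContinuum.HydrodynamicLimit.Theorems.ContactSourceDuhamel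
open Summit.AtomisticToContinuum.HydrodynamicLimit.Theorems.ContactSourceDuhamel.TimeLocal
open Literature.MathematicalPhysics.KineticTheory (hsDiameter localGibbsLaw localGibbsLaw_absolutelyContinuous)

noncomputable section

namespace Composition

/-- The Knudsen-margin arithmetic: `0 < κ`, `κ y² ≤ A + B y` ⇒ `y² ≤ 2A/κ + (B/κ)²`. -/
theorem knudsen_margin {κ A B y : ℝ} (hκ : 0 < κ) (h : κ * y ^ 2 ≤ A + B * y) :
    y ^ 2 ≤ 2 * A / κ + (B / κ) ^ 2 := by
  have h2 : 0 ≤ (B - κ * y) ^ 2 := sq_nonneg _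
  have h3 : 2 * κ * (B * y) ≤ B ^ 2 + κ ^ 2 * y ^ 2 := by nlinarith [h2]
  have h4 : κ * (κ * y ^ 2) ≤ 2 * κ * A + B ^ 2 := by nlinarith [h, h3, hκ]
  have h5 : y ^ 2 ≤ (2 * κ * A + B ^ 2) / κ ^ 2 := by
    rw [le_div_iff₀ (by positivity)]
    nlinarith [h4, hκ]
  calc y ^ 2 ≤ (2 * κ * A + B ^ 2) / κ ^ 2 := h5
    _ = 2 * A / κ + (B / κ) ^ 2 := by
      field_simp

/-- DETERMINISTIC CORE: if `κ > 0`, `P ≤ a + b √X`, `κ X − B ≤ P` and `0 ≤ X`, then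
`X ≤ 2 (a + B) / κ + (b / κ)²`. -/
theorem xint_le_of_budget_of_coercive {κ a b B P X : ℝ} (hκ : 0 < κ) (hX : 0 ≤ X)
    (hbud : P ≤ a + b * Real.sqrt X) (hcoe : κ * X - B ≤ P) :
    X ≤ 2 * (a + B) / κ + (b / κ) ^ 2 := by
  have hy : κ * Real.sqrt X ^ 2 ≤ (a + B) + b * Real.sqrt X := by
    rw [Real.sq_sqrt hX]
    linarith
  have := knudsen_margin hκ hy
  rwa [Real.sq_sqrt hX] at this

/-- A sum of three negative powers of `N + 1` tends to zero. -/
theorem tendsto_three_rpow {c₁ c₂ c₃ e₁ e₂ e₃ : ℝ} (h₁ : e₁ < 0) (h₂ : e₂ < 0) (h₃ : e₃ < 0) :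
    Tendsto (fun N : ℕ => c₁ * ((N + 1 : ℕ) : ℝ) ^ e₁ + c₂ * ((N + 1 : ℕ) : ℝ) ^ e₂ +
      c₃ * ((N + 1 : ℕ) : ℝ) ^ e₃) atTop (𝓝 0) := by
  have hcast : Tendsto (fun N : ℕ => ((N + 1 : ℕ) : ℝ)) atTop atTop :=
    tendsto_natCast_atTop_atTop.comp (tendsto_add_atTop_nat 1)
  have hpow : ∀ {e : ℝ}, e < 0 → Tendsto (fun N : ℕ => ((N + 1 : ℕ) : ℝ) ^ e) atTop (𝓝 0) := by
    intro e he
    have h := (tendsto_rpow_neg_atTop (by linarith : 0 < -e)).comp hcast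
    simpa [Function.comp_def, neg_neg] using h
  simpa using (((hpow h₁).const_mul c₁).add ((hpow h₂).const_mul c₂)).add ((hpow h₃).const_mul c₃)

/-- The EXPLICIT BOUND of the composition in three-power form: for `M > 0`,
`2 (M^γ + B)/(η M^β) + (K M^γ M^{p/2}/(η M^β))² · M^s`-free identity used twice below —
`(2/η) M^{γ−β+s} + (2B/η) M^{−β+s} + (K/η)² M^{−p+s… }`; stated as the product with `M^s`. -/
theorem bound_mul_rpow_eq {M γ β η B K p s : ℝ} (hM : 0 < M) (hη : η ≠ 0) (hp : p = β - γ) :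
    (2 * (M ^ γ + B) / (η * M ^ β) + (K * M ^ γ * M ^ (p / 2) / (η * M ^ β)) ^ 2) * M ^ s =
      (2 / η) * M ^ (γ - β + s) + (2 * B / η) * M ^ (-β + s) + (K / η) ^ 2 * M ^ (-(β - γ) + s) := by
  have hβ : M ^ β ≠ 0 := (Real.rpow_pos_of_pos hM β).ne'
  have t1 : M ^ (γ - β + s) = M ^ γ / M ^ β * M ^ s := by
    rw [Real.rpow_add hM, Real.rpow_sub hM]
  have t2 : M ^ (-β + s) = (M ^ β)⁻¹ * M ^ s := by
    rw [Real.rpow_add hM, Real.rpow_neg hM.le]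
  have t3 : M ^ (-(β - γ) + s) = (M ^ γ * M ^ (p / 2) / M ^ β) ^ 2 * M ^ s := by
    rw [Real.rpow_add hM]
    congr 1
    rw [← Real.rpow_add hM, ← Real.rpow_sub hM, ← Real.rpow_natCast, ← Real.rpow_mul hM.le]
    congr 1
    rw [hp]
    push_cast
    ring
  rw [t1, t2, t3]
  field_simp

/-- PROBABILISTIC CORE of the composition with a THRESHOLD SEQUENCE `δ_N`: the pathwise budget (for
`N ≥ N₀` on good orbits), the time-zero and tail estimates, coercivity at a power rate `β > γ`, and the
eventual domination of the explicit bound by `δ_N` give `P_N{δ_N < X} → 0`. -/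
theorem tendsto_conclusion_seq {a₀ θ₀ : T3 → ℝ} {u₀ : T3 → V3} {σ : ℝ} {Φ : Flows σ} {γ : ℝ}
    {φ : ℕ → T3 → ℝ} {t : ℝ} {K : ℝ} {N₀ : ℕ}
    (hbud : ∀ N : ℕ, N₀ ≤ N → ∀ z ∈ (Φ N).good,
        prodColl σ N (Φ N) φ t z ≤ anisC N φ ((Φ N).flow 0 z) +
          K * ((N + 1 : ℕ) : ℝ) ^ γ * Real.sqrt (vmaxInt σ N (Φ N) t z) * Real.sqrt (Xint σ N (Φ N) φ t z))
    (hZ : ∀ p : ℝ, 0 < p → Tendsto (fun N : ℕ => localGibbsLaw σ a₀ u₀ θ₀ N (Φ N)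
        {z | ((N + 1 : ℕ) : ℝ) ^ p < anisC N φ ((Φ N).flow 0 z)}) atTop (𝓝 0))
    (hH : ∀ p : ℝ, 0 < p → Tendsto (fun N : ℕ => localGibbsLaw σ a₀ u₀ θ₀ N (Φ N)
        {z | ((N + 1 : ℕ) : ℝ) ^ p < vmaxInt σ N (Φ N) t z}) atTop (𝓝 0))
    {β η B : ℝ} (hγ : 0 < γ) (hγβ : γ < β) (hη : 0 < η)
    (hcoe : Tendsto (fun N : ℕ => localGibbsLaw σ a₀ u₀ θ₀ N (Φ N)
        {z | prodColl σ N (Φ N) φ t z < η * ((N + 1 : ℕ) : ℝ) ^ β * Xint σ N (Φ N) φ t z - B})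
        atTop (𝓝 0))
    {δ : ℕ → ℝ}
    (hδ : ∀ᶠ N : ℕ in atTop,
      2 * (((N + 1 : ℕ) : ℝ) ^ γ + B) / (η * ((N + 1 : ℕ) : ℝ) ^ β) +
        (max K 0 * ((N + 1 : ℕ) : ℝ) ^ γ * ((N + 1 : ℕ) : ℝ) ^ ((β - γ) / 2) /
          (η * ((N + 1 : ℕ) : ℝ) ^ β)) ^ 2 < δ N) :
    Tendsto (fun N : ℕ => localGibbsLaw σ a₀ u₀ θ₀ N (Φ N) {z | δ N < Xint σ N (Φ N) φ t z})
      atTop (𝓝 0) := by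
  set p : ℝ := β - γ with hp_def
  have hp : 0 < p := by simp only [hp_def]; linarith
  set K' : ℝ := max K 0 with hK'_def
  have hK' : 0 ≤ K' := le_max_right _ _
  have hpos : ∀ N : ℕ, (0 : ℝ) < ((N + 1 : ℕ) : ℝ) := fun N => by exact_mod_cast Nat.succ_pos N
  -- the bad events
  let EZ : (N : ℕ) → Set (Cfg N) := fun N => {z | ((N + 1 : ℕ) : ℝ) ^ γ < anisC N φ ((Φ N).flow 0 z)}
  let EH : (N : ℕ) → Set (Cfg N) := fun N => {z | ((N + 1 : ℕ) : ℝ) ^ p < vmaxInt σ N (Φ N) t z}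
  let EB : (N : ℕ) → Set (Cfg N) := fun N =>
    {z | prodColl σ N (Φ N) φ t z < η * ((N + 1 : ℕ) : ℝ) ^ β * Xint σ N (Φ N) φ t z - B}
  -- deterministic inclusion, eventually in `N`
  have hN₀ : ∀ᶠ N : ℕ in atTop, N₀ ≤ N := eventually_ge_atTop N₀
  have hincl : ∀ᶠ N : ℕ in atTop,
      {z | δ N < Xint σ N (Φ N) φ t z} ⊆ EZ N ∪ EH N ∪ EB N ∪ (Φ N).goodᶜ := by
    filter_upwards [hδ, hN₀] with N hcN hNN z hz
    simp only [mem_setOf_eq] at hz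
    by_contra hnot
    simp only [mem_union, mem_compl_iff, mem_setOf_eq, not_or, not_lt, not_not, EZ, EH, EB] at hnot
    obtain ⟨⟨⟨hz0, hzH⟩, hzB⟩, hzg⟩ := hnot
    have hX : 0 ≤ Xint σ N (Φ N) φ t z := by
      unfold Xint
      exact integral_nonneg fun s => integral_nonneg fun x => by
        rw [defectSq_eq_defectC]; unfold defectC; positivity
    -- budget with `K'` and the thresholds inserted
    have hb1 := hbud N hNN z hzg
    have hsq : Real.sqrt (vmaxInt σ N (Φ N) t z) ≤ ((N + 1 : ℕ) : ℝ) ^ (p / 2) := by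
      calc Real.sqrt (vmaxInt σ N (Φ N) t z) ≤ Real.sqrt (((N + 1 : ℕ) : ℝ) ^ p) :=
            Real.sqrt_le_sqrt hzH
        _ = ((N + 1 : ℕ) : ℝ) ^ (p / 2) := by
            rw [Real.sqrt_eq_rpow, ← Real.rpow_mul (hpos N).le]
            congr 1
            ring
    have hb2 : prodColl σ N (Φ N) φ t z ≤ ((N + 1 : ℕ) : ℝ) ^ γ +
        (K' * ((N + 1 : ℕ) : ℝ) ^ γ * ((N + 1 : ℕ) : ℝ) ^ (p / 2)) * Real.sqrt (Xint σ N (Φ N) φ t z) := by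
      have hKK : K * ((N + 1 : ℕ) : ℝ) ^ γ * Real.sqrt (vmaxInt σ N (Φ N) t z) *
          Real.sqrt (Xint σ N (Φ N) φ t z) ≤
          K' * ((N + 1 : ℕ) : ℝ) ^ γ * ((N + 1 : ℕ) : ℝ) ^ (p / 2) * Real.sqrt (Xint σ N (Φ N) φ t z) := by
        have hγN : 0 ≤ ((N + 1 : ℕ) : ℝ) ^ γ := (Real.rpow_pos_of_pos (hpos N) γ).le
        have hs : 0 ≤ Real.sqrt (vmaxInt σ N (Φ N) t z) := Real.sqrt_nonneg _
        have hsX : 0 ≤ Real.sqrt (Xint σ N (Φ N) φ t z) := Real.sqrt_nonneg _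
        calc K * ((N + 1 : ℕ) : ℝ) ^ γ * Real.sqrt (vmaxInt σ N (Φ N) t z) *
              Real.sqrt (Xint σ N (Φ N) φ t z)
            ≤ K' * ((N + 1 : ℕ) : ℝ) ^ γ * Real.sqrt (vmaxInt σ N (Φ N) t z) *
              Real.sqrt (Xint σ N (Φ N) φ t z) := by
              have hrest : 0 ≤ ((N + 1 : ℕ) : ℝ) ^ γ * Real.sqrt (vmaxInt σ N (Φ N) t z) *
                  Real.sqrt (Xint σ N (Φ N) φ t z) := mul_nonneg (mul_nonneg hγN hs) hsX
              have hKle : K ≤ K' := le_max_left _ _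
              nlinarith [hrest, hKle]
          _ ≤ K' * ((N + 1 : ℕ) : ℝ) ^ γ * ((N + 1 : ℕ) : ℝ) ^ (p / 2) *
              Real.sqrt (Xint σ N (Φ N) φ t z) := by
              gcongr
      linarith
    have hκ : 0 < η * ((N + 1 : ℕ) : ℝ) ^ β := mul_pos hη (Real.rpow_pos_of_pos (hpos N) β)
    have hcoe' : η * ((N + 1 : ℕ) : ℝ) ^ β * Xint σ N (Φ N) φ t z - B ≤ prodColl σ N (Φ N) φ t z := hzB
    have hmain := xint_le_of_budget_of_coercive (B := B) hκ hX hb2 hcoe'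
    have : Xint σ N (Φ N) φ t z < δ N := lt_of_le_of_lt hmain (by simpa [hp_def, hK'_def] using hcN)
    linarith
  -- measure bound, eventually in `N`
  have hgood : ∀ N : ℕ, localGibbsLaw σ a₀ u₀ θ₀ N (Φ N) (Φ N).goodᶜ = 0 := fun N =>
    localGibbsLaw_absolutelyContinuous σ a₀ u₀ θ₀ N (Φ N) (Φ N).measure_compl_good
  have hle : ∀ᶠ N : ℕ in atTop, localGibbsLaw σ a₀ u₀ θ₀ N (Φ N) {z | δ N < Xint σ N (Φ N) φ t z} ≤
      localGibbsLaw σ a₀ u₀ θ₀ N (Φ N) (EZ N) + localGibbsLaw σ a₀ u₀ θ₀ N (Φ N) (EH N) +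
        localGibbsLaw σ a₀ u₀ θ₀ N (Φ N) (EB N) := by
    filter_upwards [hincl] with N hN
    calc localGibbsLaw σ a₀ u₀ θ₀ N (Φ N) {z | δ N < Xint σ N (Φ N) φ t z}
        ≤ localGibbsLaw σ a₀ u₀ θ₀ N (Φ N) (EZ N ∪ EH N ∪ EB N ∪ (Φ N).goodᶜ) := measure_mono hN
      _ ≤ localGibbsLaw σ a₀ u₀ θ₀ N (Φ N) (EZ N ∪ EH N ∪ EB N) +
            localGibbsLaw σ a₀ u₀ θ₀ N (Φ N) (Φ N).goodᶜ := measure_union_le _ _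
      _ = localGibbsLaw σ a₀ u₀ θ₀ N (Φ N) (EZ N ∪ EH N ∪ EB N) := by rw [hgood, add_zero]
      _ ≤ localGibbsLaw σ a₀ u₀ θ₀ N (Φ N) (EZ N ∪ EH N) + localGibbsLaw σ a₀ u₀ θ₀ N (Φ N) (EB N) :=
            measure_union_le _ _
      _ ≤ _ := by
            gcongr
            exact measure_union_le _ _
  have hsum : Tendsto (fun N : ℕ => localGibbsLaw σ a₀ u₀ θ₀ N (Φ N) (EZ N) +
      localGibbsLaw σ a₀ u₀ θ₀ N (Φ N) (EH N) + localGibbsLaw σ a₀ u₀ θ₀ N (Φ N) (EB N)) atTop (𝓝 0) := by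
    have := ((hZ γ hγ).add (hH p hp)).add hcoe
    rw [add_zero, add_zero] at this
    exact this
  exact tendsto_of_tendsto_of_tendsto_of_le_of_le' tendsto_const_nhds hsum
    (Eventually.of_forall fun N => bot_le) hle

/-- The explicit bound tends to zero (`0 < γ < β`, `0 < η`), so every FIXED threshold `δ > 0` eventually
dominates it. -/
theorem eventually_bound_lt {γ β η B K δ : ℝ} (hγ : 0 < γ) (hγβ : γ < β) (hη : 0 < η) (hδ : 0 < δ) :
    ∀ᶠ N : ℕ in atTop,
      2 * (((N + 1 : ℕ) : ℝ) ^ γ + B) / (η * ((N + 1 : ℕ) : ℝ) ^ β) +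
        (K * ((N + 1 : ℕ) : ℝ) ^ γ * ((N + 1 : ℕ) : ℝ) ^ ((β - γ) / 2) /
          (η * ((N + 1 : ℕ) : ℝ) ^ β)) ^ 2 < δ := by
  have hpos : ∀ N : ℕ, (0 : ℝ) < ((N + 1 : ℕ) : ℝ) := fun N => by exact_mod_cast Nat.succ_pos N
  have hlim := tendsto_three_rpow (c₁ := 2 / η) (c₂ := 2 * B / η) (c₃ := (K / η) ^ 2)
    (by linarith : γ - β + 0 < 0) (by linarith : -β + 0 < 0) (by linarith : -(β - γ) + 0 < 0)
  have hev := hlim.eventually (gt_mem_nhds hδ)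
  filter_upwards [hev] with N hN
  have e := bound_mul_rpow_eq (B := B) (K := K) (s := 0) (hpos N) hη.ne' (rfl : β - γ = β - γ)
  rw [Real.rpow_zero, mul_one] at e
  rwa [e]

/-- With the RATE threshold `δ_N = (N+1)^{−(β−γ)/2}` the explicit bound is still eventually dominated
(its product with `(N+1)^{(β−γ)/2}` is again a sum of three negative powers). -/
theorem eventually_bound_lt_rate {γ β η B K : ℝ} (hγ : 0 < γ) (hγβ : γ < β) (hη : 0 < η) :
    ∀ᶠ N : ℕ in atTop,
      2 * (((N + 1 : ℕ) : ℝ) ^ γ + B) / (η * ((N + 1 : ℕ) : ℝ) ^ β) +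
        (K * ((N + 1 : ℕ) : ℝ) ^ γ * ((N + 1 : ℕ) : ℝ) ^ ((β - γ) / 2) /
          (η * ((N + 1 : ℕ) : ℝ) ^ β)) ^ 2 < ((N + 1 : ℕ) : ℝ) ^ (-((β - γ) / 2)) := by
  have hpos : ∀ N : ℕ, (0 : ℝ) < ((N + 1 : ℕ) : ℝ) := fun N => by exact_mod_cast Nat.succ_pos N
  have hlim := tendsto_three_rpow (c₁ := 2 / η) (c₂ := 2 * B / η) (c₃ := (K / η) ^ 2)
    (by linarith : γ - β + (β - γ) / 2 < 0) (by linarith : -β + (β - γ) / 2 < 0)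
    (by linarith : -(β - γ) + (β - γ) / 2 < 0)
  have hev := hlim.eventually (gt_mem_nhds zero_lt_one)
  filter_upwards [hev] with N hN
  have hM := hpos N
  have e := bound_mul_rpow_eq (B := B) (K := K) (s := (β - γ) / 2) hM hη.ne' (rfl : β - γ = β - γ)
  rw [← e] at hN
  have hMs : 0 < ((N + 1 : ℕ) : ℝ) ^ ((β - γ) / 2) := Real.rpow_pos_of_pos hM _
  rw [Real.rpow_neg hM.le, inv_eq_one_div, lt_div_iff₀ hMs]
  exact hN

end Composition

open Composition in
/-- **PER-HORIZON CONDITIONAL (H1-free, the shape a pre-shock bridge consumes).** Fix `0 < σ < 1/2`, nice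
profiles, a flow family `Φ`, an admissible kernel family (`0 < γ ≤ 1/15`) and a horizon `t > 0` with the H2 tail
bound on `[0, t]`. IF the collisional production is coercive at a power rate on that horizon — `β > γ`, `η > 0`,
`B` with `P_N{prodColl < η (N+1)^β X − B} → 0` — THEN the crux functional on `[0, t]` vanishes in probability:
`P_N{δ < X} → 0` for every `δ > 0` (landed budget + statics + tails + `knudsen_margin`). CONDITIONAL on `hcoe`. -/
theorem tendsto_xint_of_coercivityOn {σ : ℝ} (hσ : 0 < σ) (hσ2 : σ < 2⁻¹) {a₀ θ₀ : T3 → ℝ} {u₀ : T3 → V3}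
    (hnice : NiceProfiles a₀ θ₀ u₀) (Φ : Flows σ) {γ C : ℝ} {φ : ℕ → T3 → ℝ} (hγ : 0 < γ) (hγ' : γ ≤ 1 / 15)
    (hadm : AdmissibleKernel γ C φ) {t : ℝ} (ht : 0 < t) (hT : TailsOn σ a₀ θ₀ u₀ Φ t) {β η B : ℝ}
    (hγβ : γ < β) (hη : 0 < η)
    (hcoe : Tendsto (fun N : ℕ => localGibbsLaw σ a₀ u₀ θ₀ N (Φ N)
      {z | prodColl σ N (Φ N) φ t z < η * ((N + 1 : ℕ) : ℝ) ^ β * Xint σ N (Φ N) φ t z - B}) atTop (𝓝 0))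
    {δ : ℝ} (hδ : 0 < δ) :
    Tendsto (fun N : ℕ => localGibbsLaw σ a₀ u₀ θ₀ N (Φ N) {z | δ < Xint σ N (Φ N) φ t z}) atTop (𝓝 0) := by
  have hP := stub_pointwise γ C φ hγ hγ' hadm
  have hL := stub_lipschitz γ C φ hγ hγ' hadm σ hσ hσ2 hP
  have hF := stub_freeStretch γ C φ hγ hγ' hadm σ hσ hσ2 hL
  obtain ⟨K, N₀, hbud⟩ := stub_pathwiseBudget γ C φ hγ hγ' hadm σ hσ hσ2 hF
  exact tendsto_conclusion_seq (δ := fun _ => δ) (fun N hN z hz => hbud N hN (Φ N) t ht.le z hz)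
    (fun p hp => stub_timeZero a₀ θ₀ u₀ hnice σ hσ hσ2 γ C φ hγ hγ' hadm Φ p hp)
    (fun p hp => stub_tailsVmax a₀ θ₀ u₀ hnice σ hσ hσ2 Φ t ht hT p hp) hγ hγβ hη hcoe
    (eventually_bound_lt (B := B) (K := max K 0) hγ hγβ hη hδ)

open Composition in
/-- **PER-HORIZON RATE (H1-free).** Under the same per-horizon coercivity hypothesis the crux functional on
`[0, t]` vanishes AT A POWER RATE: `P_N{(N+1)^{−(β−γ)/2} < X} → 0`. CONDITIONAL on `hcoe`. -/
theorem tendsto_xint_rate_of_coercivityOn {σ : ℝ} (hσ : 0 < σ) (hσ2 : σ < 2⁻¹) {a₀ θ₀ : T3 → ℝ}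
    {u₀ : T3 → V3} (hnice : NiceProfiles a₀ θ₀ u₀) (Φ : Flows σ) {γ C : ℝ} {φ : ℕ → T3 → ℝ} (hγ : 0 < γ)
    (hγ' : γ ≤ 1 / 15) (hadm : AdmissibleKernel γ C φ) {t : ℝ} (ht : 0 < t) (hT : TailsOn σ a₀ θ₀ u₀ Φ t)
    {β η B : ℝ} (hγβ : γ < β) (hη : 0 < η)
    (hcoe : Tendsto (fun N : ℕ => localGibbsLaw σ a₀ u₀ θ₀ N (Φ N)
      {z | prodColl σ N (Φ N) φ t z < η * ((N + 1 : ℕ) : ℝ) ^ β * Xint σ N (Φ N) φ t z - B}) atTop (𝓝 0)) :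
    Tendsto (fun N : ℕ => localGibbsLaw σ a₀ u₀ θ₀ N (Φ N)
      {z | ((N + 1 : ℕ) : ℝ) ^ (-((β - γ) / 2)) < Xint σ N (Φ N) φ t z}) atTop (𝓝 0) := by
  have hP := stub_pointwise γ C φ hγ hγ' hadm
  have hL := stub_lipschitz γ C φ hγ hγ' hadm σ hσ hσ2 hP
  have hF := stub_freeStretch γ C φ hγ hγ' hadm σ hσ hσ2 hL
  obtain ⟨K, N₀, hbud⟩ := stub_pathwiseBudget γ C φ hγ hγ' hadm σ hσ hσ2 hF
  exact tendsto_conclusion_seq (δ := fun N => ((N + 1 : ℕ) : ℝ) ^ (-((β - γ) / 2)))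
    (fun N hN z hz => hbud N hN (Φ N) t ht.le z hz)
    (fun p hp => stub_timeZero a₀ θ₀ u₀ hnice σ hσ hσ2 γ C φ hγ hγ' hadm Φ p hp)
    (fun p hp => stub_tailsVmax a₀ θ₀ u₀ hnice σ hσ hσ2 Φ t ht hT p hp) hγ hγβ hη hcoe
    (eventually_bound_lt_rate (B := B) (K := max K 0) hγ hγβ hη)

/-- **THE CRUX CONDITIONAL ON PRODUCTION COERCIVITY.** If for all nice profiles there is `σ₀ > 0` such
that for `0 < σ < σ₀`, every flow family with diffuse backward influence (H1), every admissible kernel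
family (`0 < γ ≤ 1/15`) and every `t > 0` with the H2 tail bound on `[0, t]` there are `β > γ`, `η > 0`,
`B` with `P_N{prodColl < η (N+1)^β X − B} → 0` (the registered `stub_coercivity` of the line `Sketch`,
verbatim), then the crux `CollisionIsometryCLT.AdaptedWeightCLT` (rev 12, time-local) holds — by the
landed budget `stub_pointwise`/`stub_lipschitz`/`stub_freeStretch`/`stub_pathwiseBudget`, the statics
`stub_timeZero`, the tails `stub_tailsVmax`, and `adaptedWeightCLT_iff` / `cruxTailT_of_conclOn` /
`conclOn_of_tendsto_defect`. CONDITIONAL result: the hypothesis is not proved anywhere. -/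
theorem adaptedWeightCLT_of_coercivity
    (hcoe : ∀ (a₀ θ₀ : T3 → ℝ) (u₀ : T3 → V3), NiceProfiles a₀ θ₀ u₀ →
      ∃ σ₀ : ℝ, 0 < σ₀ ∧ ∀ σ : ℝ, 0 < σ → σ < σ₀ → ∀ Φ : Flows σ, DiffuseAt σ a₀ θ₀ u₀ Φ →
        ∀ (γ C : ℝ) (φ : ℕ → T3 → ℝ), 0 < γ → γ ≤ 1 / 15 → AdmissibleKernel γ C φ →
          ∀ t : ℝ, 0 < t → TailsOn σ a₀ θ₀ u₀ Φ t →
            ∃ β η B : ℝ, γ < β ∧ 0 < η ∧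
              Tendsto (fun N : ℕ => localGibbsLaw σ a₀ u₀ θ₀ N (Φ N)
                {z | prodColl σ N (Φ N) φ t z <
                  η * ((N + 1 : ℕ) : ℝ) ^ β * Xint σ N (Φ N) φ t z - B}) atTop (𝓝 0)) :
    Summit.AtomisticToContinuum.HydrodynamicLimit.Theses.CollisionIsometryCLT.AdaptedWeightCLT := by
  rw [adaptedWeightCLT_iff]
  intro a₀ θ₀ u₀ ha hθ hu ha0 hθ0
  have hnice : NiceProfiles a₀ θ₀ u₀ := ⟨ha, hθ, hu, ha0, hθ0⟩
  obtain ⟨σ₀, hσ₀, H5⟩ := hcoe a₀ θ₀ u₀ hnice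
  refine ⟨min σ₀ 2⁻¹, lt_min hσ₀ (by norm_num), fun σ hσ hσlt Φ hDiff => ?_⟩
  have hσ₀' : σ < σ₀ := lt_of_lt_of_le hσlt (min_le_left _ _)
  have hσ2 : σ < 2⁻¹ := lt_of_lt_of_le hσlt (min_le_right _ _)
  refine cruxTailT_of_conclOn fun t ht hT => ?_
  refine SourceContraction.conclOn_of_tendsto_defect fun γ C φ hγ hγ' hadm δ hδ => ?_
  obtain ⟨β, η, B, hγβ, hη, hco⟩ := H5 σ hσ hσ₀' Φ hDiff γ C φ hγ hγ' hadm t ht hT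
  exact tendsto_xint_of_coercivityOn hσ hσ2 hnice Φ hγ hγ' hadm ht hT hγβ hη hco hδ

/-- **CERTIFICATE OF STRENGTH of the coercivity hypothesis.** Under the same hypothesis the crux
functional vanishes AT A POWER RATE: for nice profiles, `0 < σ < min σ₀ 2⁻¹`, H1, admissible kernels,
`t > 0` with H2 on `[0,t]`, with the `β > γ` supplied by the hypothesis,
`P_N{(N+1)^{−(β−γ)/2} < ∫₀ᵗ ∫ₓ Σ D² + |q|²} → 0`. The crux only asks `P_N{δ < …} → 0` for fixed `δ > 0`;
so `stub_coercivity` is, modulo the landed budget of the line, the conclusion WITH A RATE — a statement at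
least as strong as the crux itself (the line lead's `promote-stub` evidence). CONDITIONAL result. -/
theorem rate_of_coercivity
    (hcoe : ∀ (a₀ θ₀ : T3 → ℝ) (u₀ : T3 → V3), NiceProfiles a₀ θ₀ u₀ →
      ∃ σ₀ : ℝ, 0 < σ₀ ∧ ∀ σ : ℝ, 0 < σ → σ < σ₀ → ∀ Φ : Flows σ, DiffuseAt σ a₀ θ₀ u₀ Φ →
        ∀ (γ C : ℝ) (φ : ℕ → T3 → ℝ), 0 < γ → γ ≤ 1 / 15 → AdmissibleKernel γ C φ →
          ∀ t : ℝ, 0 < t → TailsOn σ a₀ θ₀ u₀ Φ t →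
            ∃ β η B : ℝ, γ < β ∧ 0 < η ∧
              Tendsto (fun N : ℕ => localGibbsLaw σ a₀ u₀ θ₀ N (Φ N)
                {z | prodColl σ N (Φ N) φ t z <
                  η * ((N + 1 : ℕ) : ℝ) ^ β * Xint σ N (Φ N) φ t z - B}) atTop (𝓝 0)) :
    ∀ (a₀ θ₀ : T3 → ℝ) (u₀ : T3 → V3), NiceProfiles a₀ θ₀ u₀ →
      ∃ σ₀ : ℝ, 0 < σ₀ ∧ ∀ σ : ℝ, 0 < σ → σ < σ₀ → ∀ Φ : Flows σ, DiffuseAt σ a₀ θ₀ u₀ Φ →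
        ∀ (γ C : ℝ) (φ : ℕ → T3 → ℝ), 0 < γ → γ ≤ 1 / 15 → AdmissibleKernel γ C φ →
          ∀ t : ℝ, 0 < t → TailsOn σ a₀ θ₀ u₀ Φ t →
            ∃ a : ℝ, 0 < a ∧
              Tendsto (fun N : ℕ => localGibbsLaw σ a₀ u₀ θ₀ N (Φ N)
                {z | ((N + 1 : ℕ) : ℝ) ^ (-a) < Xint σ N (Φ N) φ t z}) atTop (𝓝 0) := by
  intro a₀ θ₀ u₀ hnice
  obtain ⟨σ₀, hσ₀, H5⟩ := hcoe a₀ θ₀ u₀ hnice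
  refine ⟨min σ₀ 2⁻¹, lt_min hσ₀ (by norm_num), fun σ hσ hσlt Φ hDiff γ C φ hγ hγ' hadm t ht hT => ?_⟩
  have hσ₀' : σ < σ₀ := lt_of_lt_of_le hσlt (min_le_left _ _)
  have hσ2 : σ < 2⁻¹ := lt_of_lt_of_le hσlt (min_le_right _ _)
  obtain ⟨β, η, B, hγβ, hη, hco⟩ := H5 σ hσ hσ₀' Φ hDiff γ C φ hγ hγ' hadm t ht hT
  exact ⟨(β - γ) / 2, by linarith, tendsto_xint_rate_of_coercivityOn hσ hσ2 hnice Φ hγ hγ' hadm ht hT hγβ hη hco⟩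

/-- Registered anchor of this composition file (the Knudsen-margin arithmetic of the line:
`0 < κ`, `κ y² ≤ A + B y` ⇒ `y² ≤ 2A/κ + (B/κ)²`). -/
theorem composition_anchor : ∀ (κ A B y : ℝ), 0 < κ → κ * y ^ 2 ≤ A + B * y → y ^ 2 ≤ 2 * A / κ + (B / κ) ^ 2 :=
  fun _ _ _ _ hκ h => Composition.knudsen_margin hκ h

end

end Summit.AtomisticToContinuum.HydrodynamicLimit.Theorems.ContactBalance
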